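/-
Origin: expansion seat `planner-pub-hodgecm-pv07-g2-0`, handover #8a 2026-08-18T06:50:03Z (`HOME/pub-hodgecm-pv07-g2/lean/Pv07g2/DilationResidue.lean`, md5 b672f3d5, 118 lines);
landed by the gen-7 packager in gate run 25 as `HodgeCM/PerL34/LocalFactors/DilationResidue.lean` (import ^import Pv07g2\.→import HodgeCM.PerL34.LocalFactors. ×1; import ^import Pv13g3\.→import HodgeCM.PerL34. ×1).
-/
/-
Copyright: HodgeCM publication cell (pub-hodgecm), DAG node N31g — bookkeeping `q_v = [𝒪_v : ϖ_v𝒪_v] = #k_v`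
(prover lineage pv07, gen 2).  Released under the package licence.

# `[𝒪 : ϖ𝒪] = #(𝒪/𝔪)`: pv13-g3's index IS the residue cardinality, for every uniformizer of a local field

Source under adjudication (NOT cited; this file PROVES the bookkeeping it states): PerL v5, Lemma 4.2(b), proof,
tex l. 629–630 — "`q_v^{-3|ord y|/2}`" with `q_v` the residue cardinality of `L_{0,v}`.

pv13-g3's `LocalModulus.resIndex ϖ := [𝒪 : ϖ𝒪 ∩ 𝒪]` (run 24) is the number that the KERNEL normalisation
`distribHaarChar F ϖ = (resIndex ϖ)⁻¹` produces; the tex's `q_v` is the residue cardinality `#(𝒪_v/𝔪_v)`.  For a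
uniformizer `ϖ` in the norm sense (pv07-g2 `DilationOrd.IsUniformizer`: `‖ϖ‖ < 1` generating the norm group) this
file PROVES they agree:
* `unitBallEquivInteger : (LocalModulus.unitBall F) ≃+ Valued.integer F` (both are `{‖x‖ ≤ 1}`);
* `IsUniformizer.mem_piBall_iff_mem_maximalIdeal` : `ϖ𝒪 ∩ 𝒪 ↔ 𝔪` (`‖x‖ ≤ ‖ϖ‖ ↔ ‖x‖ < 1 ↔ x` a non-unit);
* `IsUniformizer.resIndex_eq_card_residueField : resIndex ϖ = Nat.card (IsLocalRing.ResidueField (Valued.integer F))`.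
So at a split unramified place the only arithmetic input left is the identification of the residue field of the
completion `L_{0,v}` with `𝒪_{L_0}/v` (the DEFINITION of `N(v)`; kernel at `ℚ_p`: `PadicResIndex.resIndex_padic`).
Nothing is cited; no hypothesis names PerL, QW8 or a 2001-programme claim.  Axioms = the standard trio.
Unit `pub-hodgecm-pv07-g2`, 2026-08-18.
-/
import Summits.HodgeConjecture.HodgeCM.PerL34.LocalFactors.DilationOrd
import Summits.HodgeConjecture.HodgeCM.PerL34.LocalModulus

/-! PORT of `HodgeCM/PerL34/LocalFactors/DilationResidue.lean` (HodgeCMPerL run 82) — verbatim mechanical port; provenance in the PORT header line. -/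

set_option autoImplicit false

noncomputable section

open MeasureTheory MeasureTheory.Measure Set Metric IsLocalRing
open scoped NNReal

namespace HodgeCM
namespace PerL34
namespace LocalFactors
namespace DilationModel

section Residue

open scoped NormedField

variable {F : Type} [NontriviallyNormedField F] [IsUltrametricDist F]

/-- `𝒪` as pv13-g3's open additive subgroup `unitBall F = {‖x‖ ≤ 1}` IS Mathlib's valuation ring
`Valued.integer F` of the norm-induced valuation -/
def unitBallEquivInteger : (LocalModulus.unitBall F : OpenAddSubgroup F).toAddSubgroup ≃+ Valued.integer F where
  toFun x := ⟨x.1, Valued.integer.mem_iff.mpr ((LocalModulus.mem_unitBall (K := F)).mp x.2)⟩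
  invFun z := ⟨z.1, (LocalModulus.mem_unitBall (K := F)).mpr (Valued.integer.mem_iff.mp z.2)⟩
  left_inv _ := rfl
  right_inv _ := rfl
  map_add' _ _ := rfl

/-- (Ported verbatim from the HodgeCMPerL package; no docstring in the source.) -/
@[simp] theorem coe_unitBallEquivInteger (x : (LocalModulus.unitBall F : OpenAddSubgroup F).toAddSubgroup) :
    ((unitBallEquivInteger x : Valued.integer F) : F) = (x : F) := rfl

/-- `x ∈ 𝔪 ↔ ‖x‖ < 1` in the valuation ring -/
theorem mem_maximalIdeal_iff_norm_lt_one (x : Valued.integer F) : x ∈ maximalIdeal (Valued.integer F) ↔ ‖x‖ < 1 := by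
  rw [IsLocalRing.mem_maximalIdeal, mem_nonunits_iff, Valued.integer.isUnit_iff_norm_eq_one]
  exact ⟨fun h => lt_of_le_of_ne (Valued.integer.norm_le_one x) h, fun h => h.ne⟩

namespace IsUniformizer

variable {ϖ : Fˣ} (hϖ : IsUniformizer ϖ)
include hϖ

omit [IsUltrametricDist F] in
/-- for a uniformizer, `‖x‖ ≤ ‖ϖ‖ ↔ ‖x‖ < 1` -/
theorem norm_le_iff_norm_lt_one (x : F) : ‖x‖ ≤ ‖(ϖ : F)‖ ↔ ‖x‖ < 1 :=
  ⟨fun h => h.trans_lt hϖ.1, hϖ.norm_le_of_norm_lt_one x⟩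

/-- under `𝒪 ≃+ Valued.integer F`, the subgroup `ϖ𝒪 ∩ 𝒪 = {‖x‖ ≤ ‖ϖ‖}` of `𝒪` is the maximal ideal `𝔪`. -/
theorem addSubgroupOf_piBall_eq_comap_maximalIdeal :
    ((LocalModulus.piBall ϖ : OpenAddSubgroup F).toAddSubgroup).addSubgroupOf
        (LocalModulus.unitBall F : OpenAddSubgroup F).toAddSubgroup
      = ((maximalIdeal (Valued.integer F)).toAddSubgroup).comap
          (unitBallEquivInteger (F := F)).toAddMonoidHom := by
  ext x
  rw [AddSubgroup.mem_addSubgroupOf, AddSubgroup.mem_comap]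
  change (x : F) ∈ LocalModulus.piBall ϖ ↔ unitBallEquivInteger x ∈ maximalIdeal (Valued.integer F)
  rw [LocalModulus.mem_piBall, mem_maximalIdeal_iff_norm_lt_one, hϖ.norm_le_iff_norm_lt_one]
  rfl

/-- **`[𝒪 : ϖ𝒪] = #(𝒪/𝔪)`**: pv13-g3's `resIndex` of a uniformizer is the residue cardinality. -/
theorem resIndex_eq_card_residueField :
    LocalModulus.resIndex ϖ = Nat.card (ResidueField (Valued.integer F)) := by
  change (((LocalModulus.piBall ϖ : OpenAddSubgroup F).toAddSubgroup).addSubgroupOf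
    (LocalModulus.unitBall F : OpenAddSubgroup F).toAddSubgroup).index = _
  rw [hϖ.addSubgroupOf_piBall_eq_comap_maximalIdeal,
    AddSubgroup.index_comap_of_surjective (f := (unitBallEquivInteger (F := F)).toAddMonoidHom) _
      (unitBallEquivInteger (F := F)).surjective,
    AddSubgroup.index_eq_card]
  rfl

/-- … so the residue field of a local field is FINITE with at least two elements, and the kernel normalisation
reads `distribHaarChar F ϖ = (#k)⁻¹` (Weil BNT I §4 Thm 6 "mod_K(π) = q⁻¹" with `q = #k`, as a THEOREM). -/
theorem distribHaarChar_eq_inv_card_residueField [ProperSpace F] :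
    distribHaarChar F ϖ = ((Nat.card (ResidueField (Valued.integer F)) : ℝ≥0))⁻¹ := by
  rw [← hϖ.resIndex_eq_card_residueField]
  exact LocalModulus.distribHaarChar_uniformizer hϖ.1.le

/-- (Ported verbatim from the HodgeCMPerL package; no docstring in the source.) -/
theorem two_le_card_residueField [ProperSpace F] : 2 ≤ Nat.card (ResidueField (Valued.integer F)) := by
  rw [← hϖ.resIndex_eq_card_residueField]
  exact LocalModulus.two_le_resIndex hϖ.1

end IsUniformizer

/-- the residue field of a non-archimedean local field is finite (some uniformizer exists) -/
theorem finite_residueField [ProperSpace F] : Finite (ResidueField (Valued.integer F)) := by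
  obtain ⟨ϖ, hϖ⟩ := exists_isUniformizer (F := F)
  exact Nat.finite_of_card_ne_zero (by rw [← hϖ.resIndex_eq_card_residueField]; exact (LocalModulus.resIndex_pos ϖ).ne')

end Residue

end DilationModel
end LocalFactors
end PerL34
end HodgeCM

end
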